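import Mathlib
import Summits.Ventures.PercRepro.TriangleCapThreeRowDiagonal

/-!
# PercRepro — THE DIAGONAL `r = 0` OF EVERY ROW `a ≥ 4` AT SECOND ORDER, THE PIECES: the cap, the convexity of
the row `a + 1`, the cross-row deletion, and the arithmetic of the within-row deletion (p3, gen 44; part 195a)

On the diagonal cell `m = a (k − a)` of the row `a` (`a ≥ 4`, `k ≥ 2a`) the degree argument of part 194 (the row
`a = 3`) goes through UNIFORMLY IN `a`:
* THE CAP (`diag_cap_gen`): a vertex `x` of degree `k − a` makes `D` a spanning subgraph of `K(N(x)ᶜ, N(x))`.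
  With `N = N(x)` (`|N| = K = k − a`, inducing a matching of `M` edges), `R = (N ∪ {x})ᶜ` (`|R| = a − 1`),
  `P = Σ_{u ∈ R} degIn N u` and `E = adjPairs R`, the degree sum reads `2aK = 2K + 2M + 2P + E`; the max-degree cap
  on `R` gives `P + E ≤ (a − 1) K`, and «one end of each matching edge» gives `P + (a − 1) M ≤ (a − 1) K`;
  together `(a − 3) M ≤ 0`, so `M = 0` and `E = 0` — this is where `a ≥ 4` enters (the row `a = 3` needed the
  finer count of part 190b).
* THE CONVEXITY (`diag_convex_gen`): every degree in `[a + 1, k − a − 1]` gives `Σ_v d(v)² + k (k − 2a − 1) ≤ m k`.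
* THE CROSS-ROW DELETION (`diag_cross_gen`): a vertex `z` of degree `d ≤ a − 1` is deleted onto `k − 1` vertices;
  for `k + d ≤ 3a + 2` the Mantel envelope of `D − z` closes the count, for `k + d ≥ 3a + 2` the closed form on the
  cell `(k − 1, a + 1, k + d − 3a − 2)` does — the two regimes meet exactly at `k + d = 3a + 2`
  (`diag_cross_arith_env`, `diag_cross_arith_cell`).
* THE WITHIN-ROW ARITHMETIC (`diag_within_arith_bip`, `diag_within_arith_gap`): the count of a vertex of degree
  `a` deleted onto the diagonal at `k − 1` — exact in both branches.
Axioms: standard.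
-/

namespace PercRepro

namespace TriangleCap

namespace C047

open Finset

variable {V : Type*} [Fintype V] [DecidableEq V]

/-- The cap hypothesis on the diagonal: `m = a (k − a)`, `a ≤ k` ⇒ `m + a² + 0 = a k`. -/
theorem diag_cap_arith (a k m : ℕ) (hk : a ≤ k) (hm : m = a * (k - a)) : m + a * a + 0 = a * k := by
  obtain ⟨t, rfl⟩ : ∃ t, k = a + t := ⟨k - a, by omega⟩
  rw [hm, Nat.add_sub_cancel_left]
  ring

/-- **THE CAP ON THE DIAGONAL OF EVERY ROW `a ≥ 4`:** a `K₄⁻`-free graph with `a (k − a)` edges on `k ≥ 2a`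
vertices and a vertex `x` of degree `k − a` is a spanning subgraph of `K(A, Aᶜ)` for `A = N(x)ᶜ`, `|A| = a`. -/
theorem diag_cap_gen (D : SimpleGraph V) [DecidableRel D.Adj] (hK : K4mFree D) (a : ℕ) (ha : 4 ≤ a)
    (hk : 2 * a ≤ Fintype.card V) (hm : D.edgeFinset.card = a * (Fintype.card V - a)) (x : V)
    (hx : deg D x + a = Fintype.card V) :
    ∃ A : Finset V, A.card = a ∧ BipSub D A := by
  obtain ⟨N, hN⟩ : ∃ N : Finset V, N = univ.filter (fun w => D.Adj x w) := ⟨_, rfl⟩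
  have hmemN : ∀ w, w ∈ N ↔ D.Adj x w := fun w => by rw [hN, mem_filter]; simp only [mem_univ, true_and]
  have hxN : x ∉ N := fun h => D.irrefl ((hmemN x).mp h)
  have hdx : deg D x = N.card := by rw [hN]; rfl
  obtain ⟨K, hKdef⟩ : ∃ K, N.card = K := ⟨_, rfl⟩
  have hcardV : Fintype.card V = K + a := by omega
  -- the max-degree cap: every degree is `≤ k − a`
  have hcap : ∀ v, deg D v + a ≤ Fintype.card V := fun v =>
    deg_add_le_card_of_dense D hK a (by omega) hk
      (cap_arith a (Fintype.card V) D.edgeFinset.card 0 (by omega) (by omega)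
        (diag_cap_arith a (Fintype.card V) D.edgeFinset.card (by omega) hm)) v
  -- the non-neighbours `R`, `|R| = a − 1`
  obtain ⟨R, hR⟩ : ∃ R : Finset V, R = (insert x N)ᶜ := ⟨_, rfl⟩
  have hRcard : R.card + 1 = a := by
    rw [hR, card_compl, card_insert_of_notMem hxN]
    omega
  have hmemR : ∀ w, w ∈ R ↔ w ≠ x ∧ ¬ D.Adj x w := by
    intro w
    rw [hR, mem_compl, mem_insert, hmemN]
    tauto
  -- the matching inside `N`
  obtain ⟨M, hM⟩ : ∃ M, adjPairs D N = 2 * M := ⟨_, adjPairs_eq_two_mul D N⟩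
  have hTf : ∑ y ∈ N, degIn D N y = 2 * M := by rw [← adjPairs_eq_sum_degIn, hM]
  -- `P = Σ_{u ∈ R} degIn N u`, `E = adjPairs R`
  obtain ⟨P, hPdef⟩ : ∃ P, ∑ u ∈ R, degIn D N u = P := ⟨_, rfl⟩
  obtain ⟨E, hEdef⟩ : ∃ E, adjPairs D R = E := ⟨_, rfl⟩
  -- the degree sum over `{x} ∪ N ∪ R`
  have hsplit : ∀ F : V → ℕ, ∑ w, F w = F x + ∑ y ∈ N, F y + ∑ u ∈ R, F u := by
    intro F
    rw [← sum_add_sum_compl (insert x N), sum_insert hxN, ← hR]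
  have hsumN : ∑ y ∈ N, deg D y = K + 2 * M + P := by
    have h : ∀ y ∈ N, deg D y = 1 + degIn D N y + degIn D R y := by
      intro y hy
      have := deg_eq_of_mem_nbhd D x y ((hmemN y).mp hy)
      rw [← hN, ← hR] at this
      exact this
    rw [sum_congr rfl h, sum_add_distrib, sum_add_distrib, sum_const, smul_eq_mul, mul_one, hKdef, hTf,
      sum_degIn_comm D N R, hPdef]
  have hsumR : ∑ u ∈ R, deg D u = P + E := by
    have h : ∀ u ∈ R, deg D u = degIn D N u + degIn D R u := by
      intro u hu
      have := deg_eq_of_not_mem_nbhd D x u ((hmemR u).mp hu).2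
      rw [← hN, ← hR] at this
      exact this
    rw [sum_congr rfl h, sum_add_distrib, hPdef, ← adjPairs_eq_sum_degIn, hEdef]
  have hdegsum := sum_deg_eq D
  rw [hsplit, hsumN, hsumR, hdx, hKdef, hm, hcardV, Nat.add_sub_cancel] at hdegsum
  -- (1) every vertex of `R` has degree `≤ K`
  have h1 : P + E ≤ (a - 1) * K := by
    rw [← hsumR]
    calc ∑ u ∈ R, deg D u ≤ ∑ _u ∈ R, K := sum_le_sum (fun u _ => by have := hcap u; omega)
      _ = (a - 1) * K := by rw [sum_const, smul_eq_mul]; congr 1; omega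
  -- (2) every vertex of `R` has at most `K − M` neighbours in `N` (one end of each matching edge)
  have h2 : P + (a - 1) * M ≤ (a - 1) * K := by
    have h : ∀ u ∈ R, degIn D N u + M ≤ K := by
      intro u hu
      have := two_mul_degIn_add_adjPairs_le D hK (x := x) ((hmemR u).mp hu).1
      rw [← hN, hM, hKdef] at this
      omega
    have hs : ∑ u ∈ R, (degIn D N u + M) ≤ ∑ _u ∈ R, K := sum_le_sum h
    rw [sum_add_distrib, sum_const, sum_const, smul_eq_mul, smul_eq_mul, hPdef] at hs
    have e : R.card = a - 1 := by omega
    rw [e] at hs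
    exact hs
  -- hence `M = 0` and `E = 0`
  obtain ⟨a', rfl⟩ : ∃ a', a = a' + 4 := ⟨a - 4, by omega⟩
  have e1 : a' + 4 - 1 = a' + 3 := by omega
  rw [e1] at h1 h2
  have hM0 : M = 0 := by nlinarith [hdegsum, h1, h2]
  have hE0 : E = 0 := by nlinarith [hdegsum, h1, h2, hM0]
  -- no edge inside `N`, none inside `R`
  have hnoN : ∀ y ∈ N, ∀ y', D.Adj y y' → y' ∉ N := by
    intro y hy y' hyy' hy'
    have h0 : degIn D N y = 0 := by
      have hle : degIn D N y ≤ ∑ z ∈ N, degIn D N z := single_le_sum (fun _ _ => Nat.zero_le _) hy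
      rw [hTf, hM0, mul_zero] at hle
      exact Nat.le_zero.mp hle
    unfold degIn at h0
    rw [card_eq_zero, filter_eq_empty_iff] at h0
    exact h0 hy' hyy'
  have hnoR : ∀ u ∈ R, ∀ u', D.Adj u u' → u' ∉ R := by
    intro u hu u' huu' hu'
    have h0 : degIn D R u = 0 := by
      have hle : degIn D R u ≤ ∑ z ∈ R, degIn D R z := single_le_sum (fun _ _ => Nat.zero_le _) hu
      rw [← adjPairs_eq_sum_degIn, hEdef, hE0] at hle
      exact Nat.le_zero.mp hle
    unfold degIn at h0
    rw [card_eq_zero, filter_eq_empty_iff] at h0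
    exact h0 hu' huu'
  -- `D ⊆ K(Nᶜ, N)`
  refine ⟨Nᶜ, ?_, ?_⟩
  · rw [card_compl, hKdef]
    omega
  · intro p q hpq
    rw [mem_compl, mem_compl, not_not]
    constructor
    · intro hpN
      by_contra hqN
      by_cases hpx : p = x
      · subst hpx
        exact hqN ((hmemN q).mpr hpq)
      by_cases hqx : q = x
      · subst hqx
        exact hpN ((hmemN p).mpr (D.adj_symm hpq))
      have hpR : p ∈ R := (hmemR p).mpr ⟨hpx, fun h => hpN ((hmemN p).mpr h)⟩
      have hqR : q ∈ R := (hmemR q).mpr ⟨hqx, fun h => hqN ((hmemN q).mpr h)⟩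
      exact hnoR p hpR q hpq hqR
    · intro hqN hpN
      exact hnoN p hpN q hpq hqN

/-- The convexity term of the row `a + 1`: `a + 1 ≤ d ≤ k − a − 1` ⇒ `d² + (a + 1)(k − a − 1) ≤ k d`. -/
theorem convex_vertex_gen (d k a : ℕ) (h1 : a + 1 ≤ d) (h2 : d + a + 1 ≤ k) :
    d * d + (a + 1) * (k - a - 1) ≤ k * d := by
  obtain ⟨p, rfl⟩ : ∃ p, d = a + 1 + p := ⟨d - (a + 1), by omega⟩
  obtain ⟨q, rfl⟩ : ∃ q, k = a + 1 + p + a + 1 + q := ⟨k - (a + 1 + p + a + 1), by omega⟩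
  have e : a + 1 + p + a + 1 + q - a - 1 = a + 1 + p + q := by omega
  rw [e]
  nlinarith [Nat.zero_le (p * q)]

omit [DecidableEq V] in
/-- **EVERY DEGREE IN `[a + 1, k − a − 1]` ON THE DIAGONAL OF THE ROW `a`:** `Σ_v d(v)² + k (k − 2a − 1) ≤ m k`
for `m = a (k − a)`, `2a + 1 ≤ k`. -/
theorem diag_convex_gen (D : SimpleGraph V) [DecidableRel D.Adj] (a : ℕ) (hk : 2 * a + 1 ≤ Fintype.card V)
    (hm : D.edgeFinset.card = a * (Fintype.card V - a)) (hcap : ∀ v, deg D v + a + 1 ≤ Fintype.card V)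
    (hdeg : ∀ v, a + 1 ≤ deg D v) :
    ∑ v, deg D v * deg D v + Fintype.card V * (Fintype.card V - 2 * a - 1) ≤
      D.edgeFinset.card * Fintype.card V := by
  have hsum : ∑ v, (deg D v * deg D v + (a + 1) * (Fintype.card V - a - 1)) ≤ ∑ v, Fintype.card V * deg D v :=
    sum_le_sum (fun v _ => convex_vertex_gen (deg D v) (Fintype.card V) a (hdeg v) (hcap v))
  rw [sum_add_distrib, sum_const, card_univ, smul_eq_mul, ← mul_sum, sum_deg_eq] at hsum
  obtain ⟨k, hk'⟩ : ∃ k, Fintype.card V = k := ⟨_, rfl⟩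
  obtain ⟨S, hS⟩ : ∃ S, ∑ v, deg D v * deg D v = S := ⟨_, rfl⟩
  rw [hk'] at hsum hm hk
  rw [hS, hm] at hsum
  rw [hS, hk', hm]
  obtain ⟨t, rfl⟩ : ∃ t, k = 2 * a + 1 + t := ⟨k - (2 * a + 1), by omega⟩
  have e1 : 2 * a + 1 + t - a - 1 = a + t := by omega
  have e2 : 2 * a + 1 + t - 2 * a - 1 = t := by omega
  have e3 : 2 * a + 1 + t - a = a + 1 + t := by omega
  rw [e1, e3] at hsum
  rw [e2, e3]
  nlinarith [hsum]

/-- The cross-row arithmetic in the envelope regime, `k + d + e = 3a + 2` (`a = d + c + e`, `k = 2a + 2 + c`):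
the slack is `(a + d) e`. -/
theorem diag_cross_arith_env (d c e m' S' T : ℕ)
    (hm' : m' + d = (d + c + e) * (d + c + e + 2 + c))
    (hS' : S' ≤ m' * (2 * (d + c + e) + 1 + c))
    (hT : T ≤ d * (d + c + e + c)) :
    S' + 2 * T + d + d * d + 2 * (d + c + e) * (c + 1) ≤ (m' + d) * (2 * (d + c + e) + 2 + c) := by
  nlinarith [hS', hT, Nat.zero_le ((2 * d + c + e) * e)]

/-- The cross-row arithmetic in the closed-form regime, `D − z` on the cell `(k − 1, a + 1, r')` with
`k + d = 3a + 2 + r'` (`a = d + 1 + b`, `k = 2d + 3b + 5 + r'`): the slack is `2 (a − d) r'`. -/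
theorem diag_cross_arith_cell (d b r' m' S' T : ℕ)
    (hm' : m' + d = (d + 1 + b) * (d + 2 * b + 4 + r'))
    (hS' : S' + r' * (2 * d + 3 + 3 * b) ≤ m' * (2 * d + 3 * b + 4 + r'))
    (hT : T ≤ d * (d + 2 * b + 2 + r')) :
    S' + 2 * T + d + d * d + 2 * (d + 1 + b) * (b + 2 + r') ≤ (m' + d) * (2 * d + 3 * b + 5 + r') := by
  nlinarith [hS', hT, Nat.zero_le ((1 + b) * r')]

/-- **THE CROSS-ROW CASE ON THE DIAGONAL OF THE ROW `a`:** `m = a (k − a)`, `3 ≤ a`, `2a + 2 ≤ k`, every degree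
`≤ k − a − 1`, a vertex `z` of degree `≤ a − 1` ⇒ `Σ_v d(v)² + 2a (k − 2a − 1) ≤ m k`. -/
theorem diag_cross_gen (D : SimpleGraph V) [DecidableRel D.Adj] (hK : K4mFree D) (a : ℕ) (ha : 3 ≤ a)
    (hk : 2 * a + 2 ≤ Fintype.card V) (hm : D.edgeFinset.card = a * (Fintype.card V - a))
    (hcap : ∀ v, deg D v + a + 1 ≤ Fintype.card V) (z : V) (hz : deg D z + 1 ≤ a) :
    ∑ v, deg D v * deg D v + 2 * a * (Fintype.card V - 2 * a - 1) ≤ D.edgeFinset.card * Fintype.card V := by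
  have hK' := k4mFree_del D hK z
  have hcard' := card_del z
  have hedges' := card_edges_del D z
  have hsq := sum_deg_sq_del D z
  have hT := sum_del_nbhd_le D z (Fintype.card V - a - 2) (fun v => by have := hcap v; omega)
  obtain ⟨d, hd⟩ : ∃ d, deg D z = d := ⟨_, rfl⟩
  rw [hd] at hz hedges' hsq hT
  obtain ⟨T, hTdef⟩ : ∃ T, ∑ w : {v : V // v ≠ z}, (if D.Adj w.1 z then deg (del D z) w else 0) = T := ⟨_, rfl⟩
  rw [hTdef] at hsq hT
  obtain ⟨S', hS'def⟩ : ∃ S', ∑ w : {v : V // v ≠ z}, deg (del D z) w * deg (del D z) w = S' := ⟨_, rfl⟩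
  rw [hS'def] at hsq
  obtain ⟨m', hm'def⟩ : ∃ m', (del D z).edgeFinset.card = m' := ⟨_, rfl⟩
  rw [hm'def] at hedges'
  obtain ⟨k, hk'⟩ : ∃ k, Fintype.card V = k := ⟨_, rfl⟩
  have hk'' : Fintype.card {v : V // v ≠ z} = k - 1 := by omega
  rw [hk'] at hk hm hT ⊢
  have hmd : m' + d = a * (k - a) := by rw [hedges', hm]
  rw [hsq, ← hedges']
  rcases Nat.lt_or_ge (k + d) (3 * a + 2) with hsmall | hlarge
  · -- the envelope regime
    have henv := sum_deg_sq_le_of_k4mFree (del D z) hK' (by omega)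
    rw [hS'def, hm'def, hk''] at henv
    obtain ⟨c, hc⟩ : ∃ c, k = 2 * a + 2 + c := ⟨k - (2 * a + 2), by omega⟩
    obtain ⟨e, he⟩ : ∃ e, k + d + e = 3 * a + 2 := ⟨3 * a + 2 - (k + d), by omega⟩
    obtain rfl : a = d + c + e := by omega
    subst hc
    have e1 : 2 * (d + c + e) + 2 + c - 1 = 2 * (d + c + e) + 1 + c := by omega
    have e2 : 2 * (d + c + e) + 2 + c - (d + c + e) - 2 = d + c + e + c := by omega
    have e3 : 2 * (d + c + e) + 2 + c - 2 * (d + c + e) - 1 = c + 1 := by omega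
    have e4 : 2 * (d + c + e) + 2 + c - (d + c + e) = d + c + e + 2 + c := by omega
    rw [e1] at henv
    rw [e2] at hT
    rw [e4] at hmd
    rw [e3]
    exact diag_cross_arith_env d c e m' S' T hmd henv hT
  · -- the closed-form regime: `D − z` on the cell `(k − 1, a + 1, r')`
    obtain ⟨r', hr'⟩ : ∃ r', k + d = 3 * a + 2 + r' := ⟨k + d - (3 * a + 2), by omega⟩
    obtain ⟨b, hb⟩ : ∃ b, a = d + 1 + b := ⟨a - (d + 1), by omega⟩
    subst hb
    obtain rfl : k = 2 * d + 3 * b + 5 + r' := by omega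
    have e0 : 2 * d + 3 * b + 5 + r' - (d + 1 + b) = d + 2 * b + 4 + r' := by omega
    rw [e0] at hmd
    have hcell := closed_form_stability (del D z) hK' (d + 1 + b + 1) r' (by omega) (by omega) (by
      rw [hm'def, hk'']
      have e : 2 * d + 3 * b + 5 + r' - 1 = 2 * d + 3 * b + 4 + r' := by omega
      rw [e]
      nlinarith [hmd])
    rw [hS'def, hm'def, hk''] at hcell
    have e1 : 2 * d + 3 * b + 5 + r' - 1 - 1 - r' = 2 * d + 3 + 3 * b := by omega
    have e2 : 2 * d + 3 * b + 5 + r' - 1 = 2 * d + 3 * b + 4 + r' := by omega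
    rw [e1, e2] at hcell
    have e3 : 2 * d + 3 * b + 5 + r' - (d + 1 + b) - 2 = d + 2 * b + 2 + r' := by omega
    rw [e3] at hT
    have e4 : 2 * d + 3 * b + 5 + r' - 2 * (d + 1 + b) - 1 = b + 2 + r' := by omega
    rw [e4]
    exact diag_cross_arith_cell d b r' m' S' T hmd hcell hT

/-- The within-row arithmetic when `D − z` is `K_{a,k−1−a}` and the `a` neighbours of `z` lie on the large side
(`k = 2a + 2 + c`, the envelope of `D − z`, the neighbours at `≤ a`): exact. -/
theorem diag_within_arith_bip (a c m' S' T : ℕ) (hm' : m' = a * (a + 1 + c))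
    (hS' : S' ≤ m' * (2 * a + 1 + c)) (hT : T ≤ a * a) :
    S' + 2 * T + a + a * a + 2 * a * (c + 1) ≤ (m' + a) * (2 * a + 2 + c) := by
  subst hm'
  nlinarith [hS', hT]

/-- The within-row arithmetic when `D − z` is `2a (k − 2a − 2)` below `m' (k − 1)` and the neighbours of `z` are
at `≤ k − a − 2` (`k = 2a + 2 + c`): exact. -/
theorem diag_within_arith_gap (a c m' S' T : ℕ) (hm' : m' = a * (a + 1 + c))
    (hS' : S' + 2 * a * c ≤ m' * (2 * a + 1 + c)) (hT : T ≤ a * (a + c)) :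
    S' + 2 * T + a + a * a + 2 * a * (c + 1) ≤ (m' + a) * (2 * a + 2 + c) := by
  subst hm'
  nlinarith [hS', hT]

end C047

end TriangleCap

end PercRepro
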